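import Mathlib
import Summits.Ventures.PercRepro2.Defs
import Summits.Ventures.PercRepro2.Graph
import Summits.Ventures.PercRepro2.OneColourSwitch
import Summits.Ventures.PercRepro2.RegionHubSign
import Summits.Ventures.PercRepro2.SideSwitch
import Summits.Ventures.PercRepro2.TermSwitchDefs
import Summits.Ventures.PercRepro2.TermSwitchReach
import Summits.Ventures.PercRepro2.M9NoPocketDefs
import Summits.Ventures.PercRepro2.M9Unreached
import Summits.Ventures.PercRepro2.M9GeneralDSplit
import Summits.Ventures.PercRepro2.M9FourParts
import Summits.Ventures.PercRepro2.M9LinkedHD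
import Summits.Ventures.PercRepro2.M9ReachedK
import Summits.Ventures.PercRepro2.M9PsiOneDefs
import Summits.Ventures.PercRepro2.M9PsiOneWorlds
import Summits.Ventures.PercRepro2.M9PsiOneWorldsM
import Summits.Ventures.PercRepro2.M9PsiOneSurvive
import Summits.Ventures.PercRepro2.M9PsiOneLink
import Summits.Ventures.PercRepro2.M9PsiOneLinkW
import Summits.Ventures.PercRepro2.M9PsiOneSigma
import Summits.Ventures.PercRepro2.M9PsiOneInj
import Summits.Ventures.PercRepro2.M9PsiOneDirty
import Summits.Ventures.PercRepro2.M9PsiOneSum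
import Summits.Ventures.PercRepro2.M9PsiOneRest
import Summits.Ventures.PercRepro2.M9PsiTwoDefs
import Summits.Ventures.PercRepro2.M9PsiTwoWorlds
import Summits.Ventures.PercRepro2.M9PsiTwoNoLink
import Summits.Ventures.PercRepro2.M9PsiTwoLink
import Summits.Ventures.PercRepro2.M9PsiTwoSigma
import Summits.Ventures.PercRepro2.M9PsiTwoDirty
import Summits.Ventures.PercRepro2.M9PsiTwoUnrooted
import Summits.Ventures.PercRepro2.M9PsiTwoRooted
import Summits.Ventures.PercRepro2.M9PsiTwoRootedY
import Summits.Ventures.PercRepro2.M9PsiTwoRootedPure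
import Summits.Ventures.PercRepro2.M9PsiTwoInjAll
import Summits.Ventures.PercRepro2.M9PsiOneHD

/-!
# The sharpened crux ⟦2EXHD⟧ reduced to the residual (RES) (blind cell PercRepro2, p3 g34,
2026-08-29; `proofs/P3-REST2.md` §2)

With the two injections in the kernel, the crux `2·EX + HD ≤ 0` is EQUIVALENT to the residual
statement
  (RES′) `Σ_{HD^K ∖ (Ψ₁(EX⁺⁺) ∪ Ψ₂(EX⁻⁻))} σ_pq σ_rs + #(Ψ₁(EX⁺⁺) ∩ Ψ₂(EX⁻⁻)) ≤ #EX_neg`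
— the dirty one-sided `K`-points not paying a positive doubly-reached point, plus the collisions
of the two positive images, sum to at most the number of negative doubly-reached points.  This
file proves the direction needed for the crux (`two_ex_add_hd_nonpos_of_res`): the images of the
positive sources are `−1` points of `HD^K` (`sigma_mul_psiOne_of_pos'`, `sigma_mul_psiTwo_of_neg`),
of the same number as their sources (injectivity), so
`EX + HD^K = Σ_{rest} + #collisions − #EX_neg`.  Own work; std axioms.
-/

namespace Summit.Ventures.PercRepro2

namespace NoPocket

open Finset Classical RegionHub OneColourSwitch SideSwitch TermSwitch

variable {V : Type*} {E : Type*}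

section Res

variable [Fintype E] [DecidableEq E] {ends : E → Sym2 V} {p q r s d : V}

/-- The dirty one-sided `K`-points as a finset. -/
noncomputable def hdKSet (ends : E → Sym2 V) (p q r s d : V) : Finset (Config E) :=
  univ.filter (fun ω => HD ends p q r s d ω ∧ d ∈ K2 ends r s ω)

/-- The positive `σ_rs = +1` doubly-reached colourings (`σ_pq = +1`). -/
noncomputable def exPP (ends : E → Sym2 V) (p q r s d : V) : Finset (Config E) :=
  (exPlusSet ends p q r s d).filter (fun ω => sigma ends ω p q = 1)

/-- The positive `σ_rs = −1` doubly-reached colourings (`σ_pq = −1`). -/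
noncomputable def exMM (ends : E → Sym2 V) (p q r s d : V) : Finset (Config E) :=
  (exMinusSet ends p q r s d).filter (fun ω => sigma ends ω p q = -1)

/-- The negative doubly-reached colourings (`σ_pq σ_rs = −1`). -/
noncomputable def exNeg (ends : E → Sym2 V) (p q r s d : V) : Finset (Config E) :=
  univ.filter (fun ω => IsEX ends p q r s d ω ∧ sigma ends ω p q * sigma ends ω r s = -1)

/-- `hdKSum` is the sum over `hdKSet`. -/
lemma hdKSum_eq_sum_hdKSet :
    hdKSum ends p q r s d = ∑ ω ∈ hdKSet ends p q r s d, sigma ends ω p q * sigma ends ω r s := by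
  unfold hdKSum hdKSet
  rw [Finset.sum_filter]

/-- The image of a positive `σ_rs = −1` source is a `−1` point (no edge `r–s`). -/
lemma sigma_mul_psiTwo_of_neg (hrs : ∀ e, ends e ≠ s(r, s)) {ω : Config E}
    (hω : ω ∈ exMM ends p q r s d) :
    sigma ends (psiTwo ends r s d ω) p q * sigma ends (psiTwo ends r s d ω) r s = -1 := by
  obtain ⟨hω', hpq⟩ := Finset.mem_filter.1 hω
  obtain ⟨h, hY, hc⟩ := mem_exMinusSet.1 hω'
  rw [sigma_psiTwo_rs h hrs hc, mul_one]
  have h1 := sigma_psiTwo_pq_le h (p := p) (q := q)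
  have h2 := sigma_ge_neg_one (ends := ends) (psiTwo ends r s d ω) p q
  omega

/-- The image of a positive `σ_rs = +1` source is a `−1` point (no edge `r–s`). -/
lemma sigma_mul_psiOne_of_pos' (hrs : ∀ e, ends e ≠ s(r, s)) {ω : Config E}
    (hω : ω ∈ exPP ends p q r s d) :
    sigma ends (psiOne ends r s d ω) p q * sigma ends (psiOne ends r s d ω) r s = -1 := by
  obtain ⟨hω', hpq⟩ := Finset.mem_filter.1 hω
  obtain ⟨h, hY, _⟩ := mem_exPlusSet.1 hω'
  rw [sigma_rs_psiOne h hrs hY, mul_one]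
  have h1 := sigma_psiOne_le_neg h (p := p) (q := q)
  have h2 := sigma_ge_neg_one (ends := ends) (psiOne ends r s d ω) p q
  omega

/-- The images of the positive sources lie in `hdKSet` (no edge `r–s`). -/
lemma image_pos_subset_hdKSet (hrs : ∀ e, ends e ≠ s(r, s)) :
    (exPP ends p q r s d).image (psiOne ends r s d) ∪
      (exMM ends p q r s d).image (psiTwo ends r s d) ⊆ hdKSet ends p q r s d := by
  intro ω' hω'
  rw [Finset.mem_union, Finset.mem_image, Finset.mem_image] at hω'
  rw [hdKSet, Finset.mem_filter]
  refine ⟨Finset.mem_univ _, ?_⟩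
  rcases hω' with ⟨ω, hω, rfl⟩ | ⟨ω, hω, rfl⟩
  · obtain ⟨h, _, _⟩ := mem_exPlusSet.1 (Finset.mem_filter.1 hω).1
    exact ⟨HD_psiOne_of_isEX h hrs, mem_K2_psiOne h⟩
  · obtain ⟨h, _, hc⟩ := mem_exMinusSet.1 (Finset.mem_filter.1 hω).1
    exact ⟨HD_psiTwo h hrs hc, mem_K2_psiTwo h⟩

/-- The sum over the image of the positive `σ_rs = +1` sources is minus their number. -/
lemma sum_image_exPP (hrs : ∀ e, ends e ≠ s(r, s)) :
    ∑ ω ∈ (exPP ends p q r s d).image (psiOne ends r s d),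
        sigma ends ω p q * sigma ends ω r s = -((exPP ends p q r s d).card : ℤ) := by
  have hinj : Set.InjOn (psiOne ends r s d) ↑(exPP ends p q r s d) :=
    (psiOne_injOn_exPlus (p := p) (q := q) (d := d) hrs).mono
      (fun ω hω => Finset.mem_coe.2 (Finset.mem_filter.1 (Finset.mem_coe.1 hω)).1)
  rw [Finset.sum_image hinj, Finset.sum_congr rfl (fun ω hω => sigma_mul_psiOne_of_pos' hrs hω)]
  simp

/-- The sum over the image of the positive `σ_rs = −1` sources is minus their number. -/
lemma sum_image_exMM (hrs : ∀ e, ends e ≠ s(r, s)) :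
    ∑ ω ∈ (exMM ends p q r s d).image (psiTwo ends r s d),
        sigma ends ω p q * sigma ends ω r s = -((exMM ends p q r s d).card : ℤ) := by
  have hinj : Set.InjOn (psiTwo ends r s d) ↑(exMM ends p q r s d) :=
    (psiTwo_injOn_exMinus (p := p) (q := q) (d := d) hrs).mono
      (fun ω hω => Finset.mem_coe.2 (Finset.mem_filter.1 (Finset.mem_coe.1 hω)).1)
  rw [Finset.sum_image hinj, Finset.sum_congr rfl (fun ω hω => sigma_mul_psiTwo_of_neg hrs hω)]
  simp

/-- A doubly-reached colouring's term is `1` on `exPP ∪ exMM`, `−1` on `exNeg`, `0` otherwise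
(no edge at `d` to `r, s`). -/
lemma ex_term_cases (hT : ∀ e, ends e ≠ s(d, r) ∧ ends e ≠ s(d, s)) (hr : d ≠ r) (hs : d ≠ s)
    (hrs : r ≠ s) (ω : Config E) :
    (if sep2 ends p q r s ω ∧ DOne ends r s d ω ∧ (d ∈ K2 ends r s ω ∧ d ∈ M2 ends r s ω)
        then sigma ends ω p q * sigma ends ω r s else 0) =
      (if ω ∈ exPP ends p q r s d ∨ ω ∈ exMM ends p q r s d then 1 else 0) -
        (if ω ∈ exNeg ends p q r s d then 1 else 0) := by
  by_cases hE : sep2 ends p q r s ω ∧ DOne ends r s d ω ∧ (d ∈ K2 ends r s ω ∧ d ∈ M2 ends r s ω)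
  · have hEX : IsEX ends p q r s d ω := ⟨hE.1, hE.2.1, hE.2.2.1, hE.2.2.2, hT, hr, hs, hrs⟩
    rw [if_pos hE]
    simp only [exPP, exMM, exNeg, Finset.mem_filter, mem_exPlusSet, mem_exMinusSet,
      Finset.mem_univ, true_and]
    unfold sigma
    by_cases a : Conn ends ω r s <;> by_cases b : Conn ends (OneColourSwitch.compl ω) r s <;>
      by_cases c : Conn ends ω p q <;> by_cases e : Conn ends (OneColourSwitch.compl ω) p q <;>
      simp [a, b, c, e, hEX]
  · have hnE : ¬ IsEX ends p q r s d ω := fun hEX => hE ⟨hEX.sep, hEX.done, hEX.inK, hEX.inM⟩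
    rw [if_neg hE]
    simp only [exPP, exMM, exNeg, Finset.mem_filter, mem_exPlusSet, mem_exMinusSet,
      Finset.mem_univ, true_and, hnE, false_and, or_self, if_false, sub_zero]

/-- **`exSum = #exPP + #exMM − #exNeg`** (no edge at `d` to `r, s`). -/
theorem exSum_eq_card (hT : ∀ e, ends e ≠ s(d, r) ∧ ends e ≠ s(d, s)) (hr : d ≠ r) (hs : d ≠ s)
    (hrs : r ≠ s) :
    exSum ends p q r s d = ((exPP ends p q r s d).card : ℤ) + (exMM ends p q r s d).card -
      (exNeg ends p q r s d).card := by
  unfold exSum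
  rw [Finset.sum_congr rfl (fun ω _ => ex_term_cases hT hr hs hrs ω), Finset.sum_sub_distrib]
  have hdisj : Disjoint (exPP ends p q r s d) (exMM ends p q r s d) := by
    rw [Finset.disjoint_left]
    intro ω h1 h2
    have := (Finset.mem_filter.1 h1).2
    have := (Finset.mem_filter.1 h2).2
    omega
  have h1 : (∑ ω : Config E, if ω ∈ exPP ends p q r s d ∨ ω ∈ exMM ends p q r s d then (1 : ℤ)
      else 0) = ((exPP ends p q r s d ∪ exMM ends p q r s d).card : ℤ) := by
    rw [Finset.sum_boole]
    congr 1
    congr 1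
    ext ω
    simp
  have h2 : (∑ ω : Config E, if ω ∈ exNeg ends p q r s d then (1 : ℤ) else 0) =
      ((exNeg ends p q r s d).card : ℤ) := by
    rw [Finset.sum_boole]
    congr 1
    congr 1
    ext ω
    simp
  rw [h1, h2, Finset.card_union_of_disjoint hdisj]
  push_cast
  ring

/-- The positive images are `−1` points, so the sum over their intersection is minus its size
(no edge `r–s`). -/
lemma sum_inter_images (hrs : ∀ e, ends e ≠ s(r, s)) :
    ∑ ω ∈ (exPP ends p q r s d).image (psiOne ends r s d) ∩
        (exMM ends p q r s d).image (psiTwo ends r s d),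
        sigma ends ω p q * sigma ends ω r s =
      -(((exPP ends p q r s d).image (psiOne ends r s d) ∩
        (exMM ends p q r s d).image (psiTwo ends r s d)).card : ℤ) := by
  have hval : ∀ ω ∈ (exPP ends p q r s d).image (psiOne ends r s d) ∩
      (exMM ends p q r s d).image (psiTwo ends r s d),
      sigma ends ω p q * sigma ends ω r s = -1 := by
    intro ω hω
    obtain ⟨ω₁, hω₁, rfl⟩ := Finset.mem_image.1 (Finset.mem_inter.1 hω).1
    exact sigma_mul_psiOne_of_pos' hrs hω₁
  rw [Finset.sum_congr rfl hval]
  simp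

/-- **⟦2EXHD⟧ from the residual (RES′)**: if the residual dirty `K`-sum plus the number of
COLLISIONS of the two positive images is at most the number of negative doubly-reached points,
then `2·exSum + hdSum ≤ 0` (no edge at `d` to `r, s`, no edge `r–s`).  (The two positive images
can collide: `n = 9`, edges 05 15 26 27 28 36 47 48 — a source pair differing by the flip of the
outside and of the linking block.) -/
theorem two_ex_add_hd_nonpos_of_res (hT : ∀ e, ends e ≠ s(d, r) ∧ ends e ≠ s(d, s))
    (hr : d ≠ r) (hs : d ≠ s) (hrs : r ≠ s) (hrs' : ∀ e, ends e ≠ s(r, s))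
    (hres : (∑ ω ∈ hdKSet ends p q r s d \
        ((exPP ends p q r s d).image (psiOne ends r s d) ∪
          (exMM ends p q r s d).image (psiTwo ends r s d)),
        sigma ends ω p q * sigma ends ω r s) +
      (((exPP ends p q r s d).image (psiOne ends r s d) ∩
        (exMM ends p q r s d).image (psiTwo ends r s d)).card : ℤ) ≤
      ((exNeg ends p q r s d).card : ℤ)) :
    2 * exSum ends p q r s d + hdSum ends p q r s d ≤ 0 := by
  have hhd := hdSum_eq_two_mul_hdKSum (ends := ends) (p := p) (q := q) (r := r) (s := s) (d := d)
  have hsplit := Finset.sum_sdiff (f := fun ω => sigma ends ω p q * sigma ends ω r s)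
    (image_pos_subset_hdKSet (p := p) (q := q) (d := d) hrs')
  have hunion := Finset.sum_union_inter (f := fun ω => sigma ends ω p q * sigma ends ω r s)
    (s₁ := (exPP ends p q r s d).image (psiOne ends r s d))
    (s₂ := (exMM ends p q r s d).image (psiTwo ends r s d))
  rw [sum_image_exPP hrs', sum_image_exMM hrs', sum_inter_images hrs'] at hunion
  rw [hhd, hdKSum_eq_sum_hdKSet, ← hsplit, exSum_eq_card hT hr hs hrs]
  linarith

end Res

end NoPocket

end Summit.Ventures.PercRepro2
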